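import Mathlib.Analysis.SpecialFunctions.Pow.Real
import Mathlib.Analysis.SpecialFunctions.Sqrt

/-!
# EriceRemainderEnclosureHistoryAutonomyComparisonSlackSystem — (E64b) THE SELF-CONSISTENT («LOSS × SLACK») INEQUALITY SYSTEM OF A TOWER CLOSES BELOW THE
# EXCESS: reals `ρ_i ≥ 0` (pin reads, `i < n` from the OLDEST age), loads `0 ≤ x_i ≤ √2∕2`, couplings `1 − ε_{i,i′}` with `ε_{i,i′} ≤ 2·30^{−(i−i′)}`, and
# `ρ_i·(1 + x_i∕4) ≤ x_i·(η − Σ_{i′<i}(1 − ε_{i,i′})·ρ_{i′})` for every `i` ⟹ `ρ_i ≤ (3∕4)·(slack seen by age i)` and **`Σ_{i<n} ρ_i ≤ η·(1 − 4^{−n}) ≤ η`** —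
# for EVERY height `n`; pure bookkeeping (Mathlib only), the abstract half of (E64c) `…ComparisonTowerSlack`

Cell `pub-balaban`, β-function sub-cell, BINDER row D4 «RemainderConst leaves for Bałaban's split» (`HOME/BINDER-OWNERS.md`; owner lineage `b2b-balaban-beta-an4`;
this file by co-owner #2 lineage `b2b-balaban-beta-d4-p2`, generation 57), β-FLOW TEAM duty (1), FREEZE (0) honoured (def-free; imports Mathlib only).

HONEST FRAMING (page 1, verbatim and binding).  *"Discharging BetaPertH makes Bałaban's UV stability UNCONDITIONAL — a real constructive-QFT result; it is
NOT the continuum limit and NOT the Clay problem."*  THIS FILE DISCHARGES NOTHING OF THE KIND.  A finite system of linear inequalities between real numbers and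
its elementary consequence — no functional, no flow, nothing of Bałaban's; the system is the one (E64c) derives, along the comparison configuration of the
cell's own NOT-IN-PRINT comparison conjecture (E58′), from (E64a)'s gap persistence.  Row D4 class UNCHANGED (critical-path width 0; instance 0∕1; D4
DISCHARGE NO DATE).  HONEST DEPENDENCY: continuum YM on T⁴ ⇐ BetaPertH ∧ nine spine estimates (0/9 proved); BetaPertH ⇐ (D1) ∧ (D4) ∧ CAP+tail; G-an2-4
gates asym, D1 and NE2/3/4.

THE POINT (census sense (α); the COMPARISON column, conjecture (E58′)).  (E63) `STRATEGY-E58prime.md` §4 diagnosed why every «peeling» bookkeeping fails for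
many zones at a fixed ratio: a per-zone factor `< 1` against inter-zone losses `O(t)` that do not decay with the number of zones — «a proof for many zones at
fixed ratio must couple the window loss to the remaining budget (loss × slack), not add them».  THIS IS THAT COUPLING.  In the system, the pin read `ρ_{i′}` of an
OLDER age loads the window of every younger age `i` with weight `1 − ε_{i,i′} → 1` (hyper-separation), so the slack `v_i = η − Σ_{i′<i} ρ_{i′}` seen by age `i`
is what its own read can consume: `ρ_i ≤ x_i·v_i∕(1 + x_i∕4)` up to the coupling defect `Σ_{i′<i} ε_{i,i′}ρ_{i′}`; and the defect is RELATIVE to the slack —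
an older read is at most `3∕4` of ITS slack, the slacks lose at most a factor `4` per age, the defects decay like `30^{−m}`, and `Σ_m (4∕30)^m = 2∕13`: so
`ρ_i ≤ (x_i∕(1+x_i∕4))·(16∕13)·v_i ≤ (3∕4)·v_i` (`x ≤ √2∕2 ≤ 156∕217`), i.e. `v_{i+1} ≥ v_i∕4`, and the slack below the whole tower is `≥ 4^{−n}·η > 0`
(§2 `read_le_slack`, `slack_ge_pow`, `sum_le_of_slack_system`).  The induction runs from the OLDEST age down and never adds losses: each age multiplies
the slack by a factor in `[1∕4, 1]`.  The constants (`30`, `1∕4`, `2·30^{−m}`, `√2∕2`) are those (E64c) can certify from the trajectory ((E64a) `gap_persist`: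
coupling `(a′∕(a′+j))² ≥ 1 − 2j∕a′`, own window `(1∕2)² = 1∕4`; (E58b)+(E63c): `x ≤ √2∕2`); the threshold `30` is where `(x∕(1+x∕4))·(1 + (3∕4)·2∕(30f−1)·…)`
closes with `f = 1∕4` — `R = 28` would still close with `f ≈ 0.24`, `R = 20` does not (numerics `HOME/…/g57/e64/README.md`: the extremal value of the system
with all `x_i = √2∕2` is `1 − f^n`, and exceeds `1` at `R = 20`, `n ≥ 8`).

WHAT IS PROVED ([folklore]; 0 `def`, 0 sorry).  §1 `geom_sum_le`, `le_pow_mul_of_le_four_mul`.  §2 **`read_le_slack`**, **`slack_ge_pow`**, **`sum_le_of_slack_system`**.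
-/
noncomputable section
open Finset

namespace Summit.QuantumFields.BalabanUV.Beta.EriceRemainderEnclosureHistoryAutonomyComparisonSlackSystem

/-! ## §1 Two bookkeeping lemmas -/

/-- The geometric tail `Σ_{i′<i} (2∕15)^{i−i′} ≤ 2∕13`. [folklore] -/
theorem geom_sum_le (i : ℕ) : ∑ i' ∈ range i, (2 / 15 : ℝ) ^ (i - i') ≤ 2 / 13 := by
  induction i with
  | zero => norm_num
  | succ i ih =>
    rw [sum_range_succ, show i + 1 - i = 1 by omega, pow_one]
    have e : ∑ i' ∈ range i, (2 / 15 : ℝ) ^ (i + 1 - i') = 2 / 15 * ∑ i' ∈ range i, (2 / 15 : ℝ) ^ (i - i') := by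
      rw [mul_sum]
      exact sum_congr rfl fun i' hi' => by
        rw [show i + 1 - i' = (i - i') + 1 by have := mem_range.mp hi'; omega, pow_succ]; ring
    rw [e]; linarith

/-- CHAINING A ONE-STEP LOSS FACTOR `1∕4`: if `v_j ≤ 4·v_{j+1}` for all `j < i` then `v_{i′} ≤ 4^{i−i′}·v_i` for all `i′ ≤ i`. [folklore] -/
theorem le_pow_mul_of_le_four_mul {v : ℕ → ℝ} : ∀ {i : ℕ}, (∀ j < i, v j ≤ 4 * v (j + 1)) → ∀ i' ≤ i, v i' ≤ 4 ^ (i - i') * v i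
  | 0, _, i', hi' => by rw [Nat.le_zero.mp hi']; simp
  | i + 1, h4, i', hi' => by
    rcases Nat.lt_or_ge i' (i + 1) with hlt | hge
    · have ih := le_pow_mul_of_le_four_mul (i := i) (fun j hj => h4 j (Nat.lt_succ_of_lt hj)) i' (Nat.le_of_lt_succ hlt)
      have hst := h4 i (Nat.lt_succ_self i)
      have hpow : (0 : ℝ) ≤ 4 ^ (i - i') := by positivity
      calc v i' ≤ 4 ^ (i - i') * v i := ih
        _ ≤ 4 ^ (i - i') * (4 * v (i + 1)) := mul_le_mul_of_nonneg_left hst hpow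
        _ = 4 ^ (i + 1 - i') * v (i + 1) := by rw [show i + 1 - i' = (i - i') + 1 by omega, pow_succ]; ring
    · have : i' = i + 1 := le_antisymm hi' hge
      subst this; simp

/-! ## §2 The slack system closes below the excess -/

/-- **EVERY PIN READ IS AT MOST THREE QUARTERS OF THE SLACK IT SEES.**  Ages indexed `i < n` from the OLDEST (`i = 0`) down; loads `0 ≤ x_i ≤ √2∕2`; pin
reads `ρ_i ≥ 0`; an excess `η ≥ 0`; couplings of the older ages `1 − ε_{i,i′}` with `0 ≤ ε_{i,i′} ≤ 2·30^{−(i−i′)}` (`i′ < i`); and THE SYSTEM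
`ρ_i·(1 + x_i∕4) ≤ x_i·(η − Σ_{i′<i} (1 − ε_{i,i′})·ρ_{i′})` for every `i < n`.  Then, with the slacks `v_i = η − Σ_{i′<i} ρ_{i′}`: `ρ_j ≤ (3∕4)·v_j` for
every `j < n` — by induction from the oldest age: the older reads are `≤ (3∕4)·v_{i′}`, so the slacks lose at most a factor `4` per age
(`v_{i′} ≤ 4^{i−i′}·v_i`), the coupling defect is `Σ_{i′<i} ε_{i,i′}ρ_{i′} ≤ (3∕2)·v_i·Σ_{m≥1}(2∕15)^m ≤ (3∕13)·v_i`, and `(16∕13)·x ≤ (3∕4)(1+x∕4)` for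
`x ≤ √2∕2` (it needs only `x ≤ 156∕217`). [folklore] -/
theorem read_le_slack {n : ℕ} {x ρ : ℕ → ℝ} {ε : ℕ → ℕ → ℝ} {η : ℝ} (hη : 0 ≤ η)
    (hx0 : ∀ i < n, 0 ≤ x i) (hx : ∀ i < n, x i ≤ Real.sqrt 2 / 2) (hρ : ∀ i < n, 0 ≤ ρ i)
    (hε : ∀ i < n, ∀ i' < i, ε i i' ≤ 2 * (1 / 30) ^ (i - i'))
    (hsys : ∀ i < n, ρ i * (1 + x i / 4) ≤ x i * (η - ∑ i' ∈ range i, (1 - ε i i') * ρ i')) :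
    ∀ i ≤ n, ∀ j < i, ρ j ≤ 3 / 4 * (η - ∑ i' ∈ range j, ρ i') := by
  set v : ℕ → ℝ := fun j => η - ∑ i' ∈ range j, ρ i' with hv_def
  have hv0 : v 0 = η := by simp [hv_def]
  have hvsucc : ∀ j, v (j + 1) = v j - ρ j := fun j => by simp only [hv_def, sum_range_succ]; ring
  have hs2 : Real.sqrt 2 < 1.4143 := by rw [Real.sqrt_lt' (by norm_num)]; norm_num
  -- the inductive step at one age
  have hstep : ∀ i < n, (∀ j < i, ρ j ≤ 3 / 4 * v j) → ρ i ≤ 3 / 4 * v i := by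
    intro i hi ih
    have h4 : ∀ j < i, v j ≤ 4 * v (j + 1) := fun j hj => by rw [hvsucc]; linarith [ih j hj]
    have hchain := le_pow_mul_of_le_four_mul h4
    have hvi : 0 ≤ v i := by
      have := hchain 0 (Nat.zero_le i)
      rw [hv0, Nat.sub_zero] at this
      nlinarith [pow_pos (by norm_num : (0:ℝ) < 4) i]
    -- the coupling defect Σ_{i'<i} ε ρ ≤ (3/13)·v_i
    have hE : ∑ i' ∈ range i, ε i i' * ρ i' ≤ 3 / 13 * v i := by
      have hterm : ∀ i' ∈ range i, ε i i' * ρ i' ≤ 3 / 2 * v i * (2 / 15 : ℝ) ^ (i - i') := by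
        intro i' hi'
        have hi'i : i' < i := mem_range.mp hi'
        have hρi' : 0 ≤ ρ i' := hρ i' (hi'i.trans hi)
        have hc : 0 ≤ 2 * (1 / 30 : ℝ) ^ (i - i') := by positivity
        calc ε i i' * ρ i' ≤ 2 * (1 / 30 : ℝ) ^ (i - i') * ρ i' := mul_le_mul_of_nonneg_right (hε i hi i' hi'i) hρi'
          _ ≤ 2 * (1 / 30 : ℝ) ^ (i - i') * (3 / 4 * v i') := mul_le_mul_of_nonneg_left (ih i' hi'i) hc
          _ ≤ 2 * (1 / 30 : ℝ) ^ (i - i') * (3 / 4 * (4 ^ (i - i') * v i)) :=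
              mul_le_mul_of_nonneg_left (by linarith [hchain i' hi'i.le]) hc
          _ = 3 / 2 * v i * ((1 / 30 : ℝ) ^ (i - i') * 4 ^ (i - i')) := by ring
          _ = 3 / 2 * v i * (2 / 15 : ℝ) ^ (i - i') := by rw [← mul_pow]; norm_num
      calc ∑ i' ∈ range i, ε i i' * ρ i' ≤ ∑ i' ∈ range i, 3 / 2 * v i * (2 / 15 : ℝ) ^ (i - i') := sum_le_sum hterm
        _ = 3 / 2 * v i * ∑ i' ∈ range i, (2 / 15 : ℝ) ^ (i - i') := by rw [mul_sum]
        _ ≤ 3 / 2 * v i * (2 / 13) := mul_le_mul_of_nonneg_left (geom_sum_le i) (by positivity)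
        _ = 3 / 13 * v i := by ring
    -- the system at age i: ρ_i (1 + x_i/4) ≤ x_i (v_i + defect) ≤ x_i (16/13) v_i ≤ (3/4)(1 + x_i/4) v_i
    have hsi := hsys i hi
    have hsplit : η - ∑ i' ∈ range i, (1 - ε i i') * ρ i' = v i + ∑ i' ∈ range i, ε i i' * ρ i' := by
      simp only [hv_def]
      rw [sub_add, ← sum_sub_distrib]
      exact congrArg _ (sum_congr rfl fun i' _ => by ring)
    rw [hsplit] at hsi
    have hxi := hx i hi
    have hxi0 := hx0 i hi
    have h1 : ρ i * (1 + x i / 4) ≤ x i * (16 / 13 * v i) := hsi.trans (mul_le_mul_of_nonneg_left (by linarith) hxi0)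
    have h2 : x i * (16 / 13 * v i) ≤ 3 / 4 * v i * (1 + x i / 4) := by
      have : x i * (16 / 13) ≤ 3 / 4 * (1 + x i / 4) := by linarith
      nlinarith
    exact le_of_mul_le_mul_right (h1.trans h2) (by linarith)
  -- induction on i ≤ n
  intro i
  induction i with
  | zero => intro _ j hj; exact absurd hj (Nat.not_lt_zero j)
  | succ i ihi =>
    intro hi j hj
    have hi' : i < n := Nat.lt_of_succ_le hi
    have ih := ihi hi'.le
    rcases Nat.lt_succ_iff_lt_or_eq.mp hj with hlt | heq
    · exact ih j hlt
    · rw [heq]; exact hstep i hi' ih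

/-- **THE SLACK SYSTEM CLOSES BELOW THE EXCESS, QUANTITATIVELY**: under the hypotheses of `read_le_slack`, the slack below the whole tower is at least
`4^{−n}·η`: `η·(1∕4)^n ≤ η − Σ_{i<n} ρ_i`. [folklore] -/
theorem slack_ge_pow {n : ℕ} {x ρ : ℕ → ℝ} {ε : ℕ → ℕ → ℝ} {η : ℝ} (hη : 0 ≤ η)
    (hx0 : ∀ i < n, 0 ≤ x i) (hx : ∀ i < n, x i ≤ Real.sqrt 2 / 2) (hρ : ∀ i < n, 0 ≤ ρ i)
    (hε : ∀ i < n, ∀ i' < i, ε i i' ≤ 2 * (1 / 30) ^ (i - i'))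
    (hsys : ∀ i < n, ρ i * (1 + x i / 4) ≤ x i * (η - ∑ i' ∈ range i, (1 - ε i i') * ρ i')) :
    η * (1 / 4) ^ n ≤ η - ∑ i ∈ range n, ρ i := by
  have hmain := read_le_slack hη hx0 hx hρ hε hsys n le_rfl
  set v : ℕ → ℝ := fun j => η - ∑ i' ∈ range j, ρ i' with hv_def
  have h4 : ∀ j < n, v j ≤ 4 * v (j + 1) := fun j hj => by
    have e : v (j + 1) = v j - ρ j := by simp only [hv_def, sum_range_succ]; ring
    have := hmain j hj
    simp only [hv_def] at this ⊢; rw [sum_range_succ]; linarith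
  have := le_pow_mul_of_le_four_mul h4 0 (Nat.zero_le n)
  simp only [hv_def, sum_range_zero, sub_zero, Nat.sub_zero] at this
  have hp : (0 : ℝ) < 4 ^ n := by positivity
  rw [one_div_pow, mul_one_div, div_le_iff₀ hp]
  linarith

/-- **THE SLACK SYSTEM CLOSES BELOW THE EXCESS**: `Σ_{i<n} ρ_i ≤ η`. [folklore] -/
theorem sum_le_of_slack_system {n : ℕ} {x ρ : ℕ → ℝ} {ε : ℕ → ℕ → ℝ} {η : ℝ} (hη : 0 ≤ η)
    (hx0 : ∀ i < n, 0 ≤ x i) (hx : ∀ i < n, x i ≤ Real.sqrt 2 / 2) (hρ : ∀ i < n, 0 ≤ ρ i)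
    (hε : ∀ i < n, ∀ i' < i, ε i i' ≤ 2 * (1 / 30) ^ (i - i'))
    (hsys : ∀ i < n, ρ i * (1 + x i / 4) ≤ x i * (η - ∑ i' ∈ range i, (1 - ε i i') * ρ i')) :
    ∑ i ∈ range n, ρ i ≤ η := by
  have := slack_ge_pow hη hx0 hx hρ hε hsys
  have : 0 ≤ η * (1 / 4) ^ n := by positivity
  linarith

end Summit.QuantumFields.BalabanUV.Beta.EriceRemainderEnclosureHistoryAutonomyComparisonSlackSystem

end
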